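import Literature.NumberTheory.QuadraticForms.DiagonalFormIsometryEquiv
import Mathlib.LinearAlgebra.QuadraticForm.TensorProduct
import Mathlib.LinearAlgebra.TensorProduct.Pi
import Mathlib.LinearAlgebra.Dimension.Constructions
import Mathlib.RingTheory.Flat.FaithfullyFlat.Basic
import HarnessLib

/-!
# Base change of quadratic forms: functoriality, diagonal forms, isotropy

Topic `NumberTheory/QuadraticForms`; namespace `Literature.NumberTheory.QuadraticForms`. Everything here is
proved; Mathlib-only algebra plus the tree's coordinate vocabulary `DiagIsometric` / `DiagIsotropic`
(`DiagonalFormIsotropy.lean`) and its dictionary with `QuadraticMap.weightedSumSquares`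
(`DiagonalFormIsometryEquiv.lean`).

Mathlib defines the extension of scalars `Q.baseChange A : QuadraticForm A (A ⊗[R] M)` of a quadratic form
`Q : QuadraticForm R M` along an algebra `R → A` (`Mathlib.LinearAlgebra.QuadraticForm.TensorProduct`, for
`2` invertible in `R`; O'Meara's `E`-ification `EV`, §53C), but not its functoriality in `Q`. This file supplies what is needed to move the
local–global theorems of the tree (stated for diagonal forms `⟨a₁, …, aₙ⟩`, i.e. coefficient vectors) to
arbitrary quadratic forms on finite-dimensional vector spaces, the forms "`f_v`" of Serre, Ch. IV §3 being
the base changes `Q.baseChange ℚ_v`: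

* `baseChange_comp` — base change commutes with pull-back along a linear map;
  `Equivalent.baseChange` — equivalent forms have equivalent base changes (Serre IV §3.3, proof of Thm 9:
  "The necessity is trivial"); `anisotropic_iff_of_equivalent`.
* `equivalent_baseChange_weightedSumSquares` — `⟨a₁, …, aₙ⟩ ⊗_R A ≅ ⟨a₁, …, aₙ⟩_A`: the base change of a
  weighted sum of squares is the weighted sum of squares with the same weights read in `A`
  (`TensorProduct.piScalarRight`).
* `not_anisotropic_baseChange_of_not_anisotropic` — an isotropic vector stays isotropic and non-zero after a
  faithfully flat base change (e.g. any field extension); `finrank_eq_of_equivalent_baseChange` — forms that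
  become equivalent over a field extension have the same rank.
* The dictionary for an arbitrary form `Q` on a finite-dimensional space over a field `K` with `2 ≠ 0`:
  `exists_equivalent_weightedSumSquares_of_finrank_eq` (an orthogonal basis, Mathlib's
  `QuadraticForm.equivalent_weightedSumSquares`; non-zero weights when `Q` is nondegenerate, Serre IV §1.6
  "the discriminant `a₁ … aₙ` of `f` is `≠ 0` (in other words, `f` is nondegenerate)"), and, given
  `Q ≅ ⟨a⟩`, `Q' ≅ ⟨b⟩`: `not_anisotropic_iff_diagIsotropic`, `not_anisotropic_baseChange_iff_diagIsotropic`,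
  `equivalent_iff_diagIsometric`, `equivalent_baseChange_iff_diagIsometric` — isotropy / equivalence of the
  forms and of all their base changes are read off the coefficient vectors.
  Likewise for the representation of a scalar: `exists_apply_eq_iff_exists_sum`,
  `exists_baseChange_apply_eq_iff_exists_sum` (values are an invariant of the class,
  `exists_apply_eq_iff_of_equivalent`).
* `not_anisotropic_of_not_separatingLeft` — a degenerate form has a non-trivial zero (a radical vector).

## References
* J.-P. Serre, *A Course in Arithmetic*, GTM 7, Springer 1973, Ch. IV §1.6 (translations), §3.1–§3.3
  [corpus:book:serre1973-course-arithmetic pp. 31–32, 38–42]. [Serre1973]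
* O. T. O'Meara, *Introduction to Quadratic Forms*, Grundlehren 117, Springer 1963, §41B, §42A, §42D, 42:1,
  §53A/§53C "Extending the field of scalars" (`E`-ification `EV`, pp. 129–130)
  [corpus:book:o-meara1963-introduction-quadratic-forms p0138–p0140]. [Omeara1963]
-/

noncomputable section

open TensorProduct QuadraticMap

namespace Literature.NumberTheory.QuadraticForms

/-! ### Functoriality of base change -/

section Functorial

variable {R : Type*} [CommRing R] [Invertible (2 : R)]
variable {M₁ M₂ : Type*} [AddCommGroup M₁] [Module R M₁] [AddCommGroup M₂] [Module R M₂]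

/-- Base change commutes with pull-back: `(Q ∘ f) ⊗ A = (Q ⊗ A) ∘ (f ⊗ A)` (both are quadratic forms on
`A ⊗ M₁` taking the value `Q (f m) · 1` at `1 ⊗ m`, and a base change is determined by these values —
O'Meara §53A/§53C: the `E`-ification is unique, "there is exactly one `E`-linear map of `T` into `T'` which
is the identity on `V`"). [cite: Omeara1963, §53A p. 129] -/
theorem baseChange_comp {A : Type*} [CommRing A] [Algebra R A] (Q : QuadraticForm R M₂) (f : M₁ →ₗ[R] M₂) :
    QuadraticForm.baseChange A (Q.comp f) = (Q.baseChange A).comp (f.baseChange A) := by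
  refine baseChange_ext fun m => ?_
  rw [QuadraticForm.baseChange_tmul, QuadraticMap.comp_apply, QuadraticMap.comp_apply,
    LinearMap.baseChange_tmul, QuadraticForm.baseChange_tmul]

/-- **Equivalent forms have equivalent base changes** (O'Meara §53C: "isometric spaces have isometric
`E`-ifications"; Serre IV §3.3, proof of Thm 9: "The necessity is trivial"): an isometric linear
equivalence `e : Q₁ ≅ Q₂` extends to `e ⊗ A : Q₁ ⊗ A ≅ Q₂ ⊗ A`. [cite: Omeara1963, §53C p. 130] -/
theorem Equivalent.baseChange (A : Type*) [CommRing A] [Algebra R A] {Q₁ : QuadraticForm R M₁}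
    {Q₂ : QuadraticForm R M₂} (h : Q₁.Equivalent Q₂) :
    (Q₁.baseChange A).Equivalent (Q₂.baseChange A) := by
  obtain ⟨e⟩ := h
  have hQ : Q₂.comp (e.toLinearEquiv : M₁ →ₗ[R] M₂) = Q₁ := QuadraticMap.ext fun x => e.map_app x
  have key : (Q₂.baseChange A).comp ((e.toLinearEquiv : M₁ →ₗ[R] M₂).baseChange A) = Q₁.baseChange A := by
    rw [← baseChange_comp, hQ]
  refine ⟨⟨e.toLinearEquiv.baseChange R A M₁ M₂, fun x => ?_⟩⟩
  change Q₂.baseChange A ((e.toLinearEquiv : M₁ →ₗ[R] M₂).baseChange A x) = Q₁.baseChange A x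
  rw [← key, QuadraticMap.comp_apply]

end Functorial

/-! ### Anisotropy is an invariant of the equivalence class -/

section Anisotropic

variable {R : Type*} [CommRing R]
variable {M₁ M₂ : Type*} [AddCommGroup M₁] [Module R M₁] [AddCommGroup M₂] [Module R M₂]

/-- Anisotropy descends along an isometric equivalence (O'Meara §42D: isotropy is a property of the
quadratic space up to isometry). [cite: Omeara1963, §42D p. 94] -/
theorem Anisotropic.of_equivalent {Q₁ : QuadraticForm R M₁} {Q₂ : QuadraticForm R M₂} (h : Q₁.Equivalent Q₂)
    (h₂ : Q₂.Anisotropic) : Q₁.Anisotropic := by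
  obtain ⟨e⟩ := h
  intro x hx
  have hex : e x = 0 := h₂ (e x) (by rw [e.map_app, hx])
  simpa using congrArg e.symm hex

/-- Equivalent forms are anisotropic together (O'Meara §42D: isotropy is a property of the quadratic space).
[cite: Omeara1963, §42D p. 94] -/
theorem anisotropic_iff_of_equivalent {Q₁ : QuadraticForm R M₁} {Q₂ : QuadraticForm R M₂}
    (h : Q₁.Equivalent Q₂) : Q₁.Anisotropic ↔ Q₂.Anisotropic :=
  ⟨fun h₁ => Anisotropic.of_equivalent (QuadraticMap.Equivalent.symm h) h₁, Anisotropic.of_equivalent h⟩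

/-- **Equivalent forms represent the same elements** (Serre IV §1.6: "`f` represents `a`" depends only on
the equivalence class; O'Meara §41A). [cite: Serre1973, Ch. IV §1.6] -/
theorem exists_apply_eq_iff_of_equivalent {Q₁ : QuadraticForm R M₁} {Q₂ : QuadraticForm R M₂}
    (h : Q₁.Equivalent Q₂) (a : R) : (∃ x, Q₁ x = a) ↔ ∃ y, Q₂ y = a := by
  obtain ⟨e⟩ := h
  refine ⟨fun ⟨x, hx⟩ => ⟨e x, by rw [e.map_app, hx]⟩, fun ⟨y, hy⟩ => ⟨e.symm y, ?_⟩⟩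
  rw [← hy, ← e.map_app (e.symm y), QuadraticMap.IsometryEquiv.apply_symm_apply]

/-- The values of `⟨c₁, …, cₙ⟩` are the sums `∑ cᵢ xᵢ²` (O'Meara §42A: in an orthogonal base
`Q(∑ λᵢxᵢ) = ∑ Q(xᵢ)λᵢ²`). [cite: Omeara1963, §42A p. 88] -/
theorem exists_weightedSumSquares_eq_iff {n : ℕ} (c : Fin n → R) (a : R) :
    (∃ x, weightedSumSquares R c x = a) ↔ ∃ x : Fin n → R, ∑ i, c i * x i ^ 2 = a := by
  refine exists_congr fun x => ?_
  rw [weightedSumSquares_apply]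
  simp only [smul_eq_mul, _root_.sq]

end Anisotropic

/-! ### Base change of a weighted sum of squares -/

section Weighted

variable {R : Type*} (A : Type*) [CommRing R] [CommRing A] [Algebra R A]

/-- On pure tensors `1 ⊗ x`, `TensorProduct.piScalarRight` is the coordinatewise `algebraMap`. [folklore] -/
private theorem piScalarRight_one_tmul {ι : Type*} [Fintype ι] [DecidableEq ι] (x : ι → R) :
    TensorProduct.piScalarRight R A A ι ((1 : A) ⊗ₜ[R] x) = fun i => algebraMap R A (x i) := by
  rw [TensorProduct.piScalarRight_apply, TensorProduct.piScalarRightHom_tmul]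
  funext i
  rw [Algebra.algebraMap_eq_smul_one]

/-- **`⟨a₁, …, aₙ⟩ ⊗_R A ≅ ⟨a₁, …, aₙ⟩` read in `A`**: the base change of the weighted sum of squares with
weights `w` is equivalent, via `A ⊗ Rⁿ ≅ Aⁿ` (`TensorProduct.piScalarRight`), to the weighted sum of squares
over `A` with weights `algebraMap R A ∘ w` (O'Meara §53C: "`V` and `EV` have the same matrix in any given
base for `V`"; Serre IV §3.1: `f_v` is `∑ aᵢXᵢ²` with its coefficients read in `ℚ_v`).
[cite: Omeara1963, §53C p. 130] -/
theorem equivalent_baseChange_weightedSumSquares [Invertible (2 : R)] {ι : Type*} [Fintype ι] (w : ι → R) :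
    (QuadraticForm.baseChange A (weightedSumSquares R w)).Equivalent
      (weightedSumSquares A fun i => algebraMap R A (w i)) := by
  classical
  let e := TensorProduct.piScalarRight R A A ι
  -- the two quadratic forms on `A ⊗ Rⁿ` agree on pure tensors `1 ⊗ x`
  have key : (weightedSumSquares A fun i => algebraMap R A (w i)).comp (e : A ⊗[R] (ι → R) →ₗ[A] (ι → A)) =
      QuadraticForm.baseChange A (weightedSumSquares R w) := by
    refine baseChange_ext fun x => ?_
    rw [QuadraticMap.comp_apply, QuadraticForm.baseChange_tmul, mul_one, LinearEquiv.coe_coe,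
      piScalarRight_one_tmul, weightedSumSquares_apply, weightedSumSquares_apply, Finset.sum_smul]
    refine Finset.sum_congr rfl fun i _ => ?_
    rw [smul_eq_mul, smul_eq_mul, Algebra.smul_def, map_mul, map_mul, mul_one]
  exact ⟨⟨e, fun x => by rw [← key]; rfl⟩⟩

end Weighted

/-! ### Isotropic vectors survive a faithfully flat base change -/

section Isotropic

variable {K L : Type*} [Field K] [Field L] [Algebra K L]
variable {V : Type*} [AddCommGroup V] [Module K V]

/-- Over a field extension `L / K`, `1 ⊗ v = 0` only for `v = 0`: `V ⊆ LV` (O'Meara §53A: "every base for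
`V` over `F` is also a base for `T` over `E`"; here: `L` is faithfully flat over `K`).
[cite: Omeara1963, §53A p. 129] -/
theorem one_tmul_eq_zero_iff (v : V) : (1 : L) ⊗ₜ[K] v = 0 ↔ v = 0 :=
  Module.FaithfullyFlat.one_tmul_eq_zero_iff K V (A := L) v

variable [Invertible (2 : K)]

/-- The base change of a quadratic form takes the value `Q v` (read in `L`) at `1 ⊗ v` (O'Meara §53C: the
form of `EV` "agrees with the given `B` on `V`"). [cite: Omeara1963, §53C p. 130] -/
theorem baseChange_one_tmul (Q : QuadraticForm K V) (v : V) :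
    Q.baseChange L ((1 : L) ⊗ₜ[K] v) = algebraMap K L (Q v) := by
  rw [QuadraticForm.baseChange_tmul, mul_one, Algebra.algebraMap_eq_smul_one]

/-- **A non-trivial zero over `K` is a non-trivial zero over every extension `L`** (the trivial half of the
Hasse–Minkowski theorem, Serre IV §3.2 Thm 8 "necessity"; O'Meara 66:1, "only if"): if `Q` is isotropic
then so is `Q ⊗ L`. [cite: Serre1973, Ch. IV §3.2 Thm 8 (necessity)] -/
theorem not_anisotropic_baseChange_of_not_anisotropic {Q : QuadraticForm K V} (h : ¬ Q.Anisotropic) :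
    ¬ (Q.baseChange L).Anisotropic := by
  rw [QuadraticMap.not_anisotropic_iff_exists] at h ⊢
  obtain ⟨v, hv0, hv⟩ := h
  refine ⟨(1 : L) ⊗ₜ[K] v, fun h0 => hv0 ((one_tmul_eq_zero_iff v).1 h0), ?_⟩
  rw [baseChange_one_tmul, hv, map_zero]

/-- Contrapositive: a form anisotropic over some extension `L` is anisotropic over `K` (Serre IV §3.2 Thm 8,
necessity). [cite: Serre1973, Ch. IV §3.2 Thm 8 (necessity)] -/
theorem anisotropic_of_anisotropic_baseChange {Q : QuadraticForm K V} (h : (Q.baseChange L).Anisotropic) :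
    Q.Anisotropic := by
  by_contra h'
  exact not_anisotropic_baseChange_of_not_anisotropic (L := L) h' h

omit [Invertible (2 : K)] in
/-- Forms that become equivalent over a field extension have the same rank: `dim_L (L ⊗ V₁) = dim_K V₁`
(O'Meara §53A: "`dim_E EV = dim_F V`"). [cite: Omeara1963, §53A p. 129] -/
theorem finrank_eq_of_equivalent_baseChange [Invertible (2 : K)] {V₂ : Type*} [AddCommGroup V₂] [Module K V₂]
    [Module.Free K V] [Module.Free K V₂]
    {Q₁ : QuadraticForm K V} {Q₂ : QuadraticForm K V₂}
    (h : (Q₁.baseChange L).Equivalent (Q₂.baseChange L)) : Module.finrank K V = Module.finrank K V₂ := by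
  rw [← Module.finrank_baseChange (R := L) (M' := V), ← Module.finrank_baseChange (R := L) (M' := V₂)]
  exact finrank_eq_of_equivalent h

end Isotropic

/-! ### The dictionary: an arbitrary form versus its diagonalisations -/

section Dictionary

variable {K : Type*} [Field K]
variable {V V₂ : Type*} [AddCommGroup V] [Module K V] [AddCommGroup V₂] [Module K V₂]

/-- **Every quadratic form is diagonalisable** (Serre IV §1.4/§1.6, O'Meara 42:1: an orthogonal basis), in
the rank-`n` bookkeeping used below: a quadratic form on an `n`-dimensional space over a field with `2 ≠ 0`
is equivalent to some `⟨a₁, …, aₙ⟩`; Mathlib's `QuadraticForm.equivalent_weightedSumSquares`.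
[cite: Serre1973, Ch. IV §1.6] -/
theorem exists_equivalent_weightedSumSquares_of_finrank_eq' [Invertible (2 : K)] [FiniteDimensional K V]
    (Q : QuadraticForm K V) {n : ℕ} (hn : Module.finrank K V = n) :
    ∃ a : Fin n → K, Q.Equivalent (weightedSumSquares K a) := by
  subst hn
  exact Q.equivalent_weightedSumSquares

/-- **Nondegenerate forms diagonalise with non-zero weights** (Serre IV §1.6: "the discriminant `a₁ … aₙ`
of `f` is `≠ 0` (in other words, `f` is nondegenerate)"): a quadratic form on an `n`-dimensional space over a
field with `2 ≠ 0` whose associated bilinear form is left-separating is equivalent to some `⟨a₁, …, aₙ⟩`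
with all `aᵢ ≠ 0`; Mathlib's `QuadraticForm.equivalent_weightedSumSquares_units_of_nondegenerate'`.
[cite: Serre1973, Ch. IV §1.6] -/
theorem exists_equivalent_weightedSumSquares_of_finrank_eq [Invertible (2 : K)] [FiniteDimensional K V]
    (Q : QuadraticForm K V) (hQ : (QuadraticMap.associated (R := K) Q).SeparatingLeft) {n : ℕ}
    (hn : Module.finrank K V = n) :
    ∃ a : Fin n → K, (∀ i, a i ≠ 0) ∧ Q.Equivalent (weightedSumSquares K a) := by
  subst hn
  obtain ⟨w, hw⟩ := Q.equivalent_weightedSumSquares_units_of_nondegenerate' hQ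
  refine ⟨fun i => (w i : K), fun i => (w i).ne_zero, ?_⟩
  rwa [← weightedSumSquares_units_eq]

/-- **A degenerate form represents zero**: if the associated bilinear form of `Q` is not left-separating,
some non-zero `v` is orthogonal to everything, in particular `Q v = B(v, v) = 0` (Serre IV §1.2: the
radical `rad(V)`). [cite: Serre1973, Ch. IV §1.2] -/
theorem not_anisotropic_of_not_separatingLeft [Invertible (2 : K)] (Q : QuadraticForm K V)
    (hQ : ¬ (QuadraticMap.associated (R := K) Q).SeparatingLeft) : ¬ Q.Anisotropic := by
  rw [QuadraticMap.not_anisotropic_iff_exists]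
  simp only [LinearMap.SeparatingLeft, not_forall, exists_prop] at hQ
  obtain ⟨v, hv, hv0⟩ := hQ
  refine ⟨v, hv0, ?_⟩
  rw [← QuadraticMap.associated_eq_self_apply K Q v]
  exact hv v

variable {n : ℕ}

/-- **Isotropy is read off a diagonalisation**: if `Q ≅ ⟨a⟩` then `Q` has a non-trivial zero iff `⟨a⟩` is
isotropic in the coordinate sense `DiagIsotropic a` (`∃ x ≠ 0, ∑ aᵢxᵢ² = 0`). [cite: Omeara1963, §42D p. 94] -/
theorem not_anisotropic_iff_diagIsotropic {Q : QuadraticForm K V} {a : Fin n → K}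
    (h : Q.Equivalent (weightedSumSquares K a)) : ¬ Q.Anisotropic ↔ DiagIsotropic a := by
  rw [anisotropic_iff_of_equivalent h, diagIsotropic_iff_not_anisotropic]

/-- **Isotropy of every base change is read off the same diagonalisation**: if `Q ≅ ⟨a⟩` over `K` then, for
any extension `L`, `Q ⊗ L` has a non-trivial zero iff `⟨a⟩` read in `L` is isotropic (Serre IV §3.1–3.2:
`f_v` is `∑ aᵢXᵢ²` viewed over `ℚ_v`). [cite: Serre1973, Ch. IV §3.2] -/
theorem not_anisotropic_baseChange_iff_diagIsotropic [Invertible (2 : K)] {L : Type*} [Field L] [Algebra K L]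
    {Q : QuadraticForm K V} {a : Fin n → K} (h : Q.Equivalent (weightedSumSquares K a)) :
    ¬ (Q.baseChange L).Anisotropic ↔ DiagIsotropic fun i => algebraMap K L (a i) := by
  rw [anisotropic_iff_of_equivalent
      ((Equivalent.baseChange L h).trans (equivalent_baseChange_weightedSumSquares L a)),
    diagIsotropic_iff_not_anisotropic]

/-- **Equivalence is read off diagonalisations**: if `Q ≅ ⟨a⟩` and `Q' ≅ ⟨b⟩` (same rank) then `Q ≅ Q'` iff
`⟨a⟩ ≅ ⟨b⟩` as matrices, `DiagIsometric a b` (O'Meara §41B; `2 ≠ 0` for the polarisation step).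
[cite: Omeara1963, §41B] -/
theorem equivalent_iff_diagIsometric [NeZero (2 : K)] {Q₁ : QuadraticForm K V} {Q₂ : QuadraticForm K V₂}
    {a b : Fin n → K} (h₁ : Q₁.Equivalent (weightedSumSquares K a))
    (h₂ : Q₂.Equivalent (weightedSumSquares K b)) : Q₁.Equivalent Q₂ ↔ DiagIsometric a b := by
  rw [diagIsometric_iff_equivalent]
  exact ⟨fun h => ((QuadraticMap.Equivalent.symm h₁).trans h).trans h₂,
    fun h => (h₁.trans h).trans (QuadraticMap.Equivalent.symm h₂)⟩

/-- **Equivalence of all base changes is read off the same diagonalisations**: if `Q ≅ ⟨a⟩`, `Q' ≅ ⟨b⟩`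
over `K` then, for any extension `L` with `2 ≠ 0`, `Q ⊗ L ≅ Q' ⊗ L` iff `⟨a⟩ ≅ ⟨b⟩` read in `L`
(Serre IV §3.3: "`f` and `f'` … equivalent over each `ℚ_v`"). [cite: Serre1973, Ch. IV §3.3] -/
theorem equivalent_baseChange_iff_diagIsometric [Invertible (2 : K)] {L : Type*} [Field L] [Algebra K L]
    [NeZero (2 : L)] {Q₁ : QuadraticForm K V} {Q₂ : QuadraticForm K V₂} {a b : Fin n → K}
    (h₁ : Q₁.Equivalent (weightedSumSquares K a)) (h₂ : Q₂.Equivalent (weightedSumSquares K b)) :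
    (Q₁.baseChange L).Equivalent (Q₂.baseChange L) ↔
      DiagIsometric (fun i => algebraMap K L (a i)) (fun i => algebraMap K L (b i)) :=
  equivalent_iff_diagIsometric
    ((Equivalent.baseChange L h₁).trans (equivalent_baseChange_weightedSumSquares L a))
    ((Equivalent.baseChange L h₂).trans (equivalent_baseChange_weightedSumSquares L b))

/-- **Representation of a scalar is read off a diagonalisation**: if `Q ≅ ⟨a⟩` then `Q` represents `t`
iff `∑ aᵢxᵢ² = t` is solvable. [cite: Serre1973, Ch. IV §1.6] -/
theorem exists_apply_eq_iff_exists_sum {Q : QuadraticForm K V} {a : Fin n → K}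
    (h : Q.Equivalent (weightedSumSquares K a)) (t : K) :
    (∃ v, Q v = t) ↔ ∃ x : Fin n → K, ∑ i, a i * x i ^ 2 = t := by
  rw [exists_apply_eq_iff_of_equivalent h, exists_weightedSumSquares_eq_iff]

/-- **Representation by every base change is read off the same diagonalisation**: if `Q ≅ ⟨a⟩` over `K`
then, for any extension `L`, `Q ⊗ L` represents `t ∈ K` iff `∑ aᵢxᵢ² = t` is solvable in `L` (Serre IV §3.2
Cor. 1: "`f` represents `a` … in each of the `ℚ_v`"). [cite: Serre1973, Ch. IV §3.2 Cor. 1] -/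
theorem exists_baseChange_apply_eq_iff_exists_sum [Invertible (2 : K)] {L : Type*} [Field L] [Algebra K L]
    {Q : QuadraticForm K V} {a : Fin n → K} (h : Q.Equivalent (weightedSumSquares K a)) (t : K) :
    (∃ v, Q.baseChange L v = algebraMap K L t) ↔
      ∃ x : Fin n → L, ∑ i, algebraMap K L (a i) * x i ^ 2 = algebraMap K L t := by
  rw [exists_apply_eq_iff_of_equivalent
      ((Equivalent.baseChange L h).trans (equivalent_baseChange_weightedSumSquares L a)),
    exists_weightedSumSquares_eq_iff]

/-- A value of `Q` over `K` is a value of every base change `Q ⊗ L` (at `1 ⊗ v`; Serre IV §3.2 Cor. 1,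
necessity). [cite: Serre1973, Ch. IV §3.2 Cor. 1 (necessity)] -/
theorem exists_baseChange_apply_eq_of_exists [Invertible (2 : K)] {L : Type*} [Field L] [Algebra K L]
    {Q : QuadraticForm K V} {t : K} (h : ∃ v, Q v = t) : ∃ v, Q.baseChange L v = algebraMap K L t := by
  obtain ⟨v, hv⟩ := h
  exact ⟨(1 : L) ⊗ₜ[K] v, by rw [baseChange_one_tmul, hv]⟩

end Dictionary

end Literature.NumberTheory.QuadraticForms

end
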